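import Mathlib
import Literature.MathematicalPhysics.QuantumFieldTheory.Balaban1983to89.T4InputCauchyRateData
import Literature.MathematicalPhysics.QuantumFieldTheory.Balaban1983to89.T4EtaRate
import Literature.MathematicalPhysics.QuantumFieldTheory.Balaban1983to89.T4EtaRateMin

/-!
# T4OperatorRateLiaison — which typed η-rate feeds the OPERATOR binder of the NE5 Cauchy route, and in which currency
# (cell `pub-balaban`, T⁴-continuum fan-out, interface between node U1a/U1b (`T4EtaRate`, `T4EtaRateMin`) and node U3's
# NE5 prover modules (`T4InputCauchyRateData.StepModel.OperatorRate`, `T4InputCauchyRate.CauchyBlockStep` field 6,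
# `T4ActivityLipschitz.ClusterRep.InputRate`); answer to the cell's interface request C-ne5p1-2)

HONEST FRAMING.  The cell's T4 target is rung (B)+1 (existence AND uniqueness of the ε → 0 limit of Bałaban's unit-scale
expectations on a FIXED finite torus T⁴); NOT infinite volume, NOT a mass gap, NOT the Clay problem; the spine's conditionals
(BetaPertH, (B), (B^μ)) are untouched here.  NOTHING printed in the audited papers is asserted: every `def … : Prop` below is a
HYPOTHESIS SHAPE over the abstract data of the imported modules, every `theorem` is kernel-checked real bookkeeping (triangle
inequality, geometric/polynomial absorption, sup-norm packaging) or a toy.  No η-rate of any of Bałaban's operators is proved.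
Value = the TYPED JUNCTION between the producer-side shapes of nodes U1a/U1b and the consumer-side operator binder of node U3's
Cauchy route, with the currency conversions as kernel lemmas and the one obstruction (rate factor 1 at lattice-scale sites) as a
kernel witness; NOT summit progress.

## The interface question (cell GAPS C-ne5p1-2, asked by the NE5 prover seat P1) and this module's answer

ASKED: does NE3 as typed (`T4EtaRateMin.LocalRate` / `T4FixedPointResponse.OneStepCorrectionRate`) deliver the operator
discrepancy `StepModel.OperatorRate W δ θ := ∀ k, ∀ g ∈ W, ∀ U, ‖opA g U k − opB g U k‖ ≤ δ·θ^k·rOp k` in B13's kernel norms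
(1.7)/(2.16), possibly with King's exponent loss (Lʲη)^{−γ} ("δ_i/ϱ_i summable against θ^k"); else name the missing layer.

ANSWER, decl by decl ([analysis] = this seat's reading of the typed shapes; the node labels are the cell's `t4/T4-DAG.md` §2).
(A1) NOT FROM NE3.  `LocalRate R C θ` bounds `|R.loc (k+1) V x − R.loc k V x|`: SCALAR site readings of the two runs' MINIMISER
CONFIGURATIONS for a common datum V (node U1b).  `OperatorRate` compares the two runs' OPERATOR DATA at a COMMON (transported)
background `U : C.BgB` — `opA g U k` is read at `C.transport U` (the imported module's `RepresentsA`): no minimiser of either run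
is recomputed inside it.  The operator data of B13's step are LINEAR-THEORY objects at the background — the fine-lattice
propagators H, G̃, H₀ of (1.3)–(1.6) localised by random walks and measured, by (1.7), in *"all operator norms in formulations of
theorems in [13], e.g. in Theorem 3.1"* with *"Δ(y), Δ(y′) … localization cubes of the term"* (p. 3), and the unit-lattice
quadratic forms / covariances of (2.5)–(2.6), (2.15)–(2.17) with bond-indexed matrix elements *"|R₁(b, b′)| ≤ (O(1)e^{−1/3δ₀M} +
O(α₀ + α₁))exp(−½δ₀|b₋ − b′₋|)"* (2.16) (p. 16).  Their two-spacing rate at the canonical background pair (transport U, U) is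
node U1a's NE2 — its background layer NE2⁺ — typed PRODUCER-SIDE in `T4EtaRate` (this lineage, gen 3): `NE2PlusOperator` (B9
Thm 3.1's (3.42) cube operator norms = (1.7)'s currency, King's rate factor per localisation site), `NE2PlusSite`, `NE2PlusUnit`
(unit-lattice kernels = (2.16)'s currency, CLEAN θ^k).  Typed NE3 reaches NE5 elsewhere: the ARGUMENT bracket of
`T4OutputRate.u3_threeBrackets` via `T4RateLiaison.u3_of_localRate`, and the INSERTION channel `StepModel.InsertionRate`
(re-expression maps through U_k(·)).  It would enter `OperatorRate` only under an instantiation that reads the operators at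
the runs' OWN minimisers of a common coarse datum — then by the Lipschitz split of §4 (`operatorRate_of_split`: NE2⁺ at the
canonical pair + [operator Lipschitz in the background, printed-TYPE from B9 Thm 3.4 p. 400 analyticity by a Cauchy estimate]
× [minimiser sup-rate `LocalRate`, `minDist_of_localRate`]).
(A1′) SHAPE versus CONTENT.  The negative answer concerns NE3's CONTENT (minimiser readings).  The SHAPE `LocalRate` over the
abstract carrier `Readings ι X` is species-agnostic — `loc k V x` may be ANY scalar family, in particular an operator's
kernel ENTRY computed with k fine scales below the unit lattice, and its consecutive-step form `|loc (k+1) − loc k| ≤ Cθ^k`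
is exactly the two-run comparison at a common step (run A has one fine scale more).  In that reading `LocalRate` IS an
entrywise operator rate, uniform over the entries, and §2's `absRate_of_localRate` + §1 turn it into `OperatorRate`
mechanically.  A hypothesis-free kernel INSTANCE of this kind exists in the tree for ONE species: the unit-lattice
fluctuation covariance C^{(k)}(𝟙) of B6 (2.156) at U = 1 on every fixed unit torus, θ = L⁻¹ (`T4Cov2156Rate.cov2156_localRate`,
cell lineage t4-ne2-p2, NE2's unit layer at U = 1 — King's (4.38); not imported here, named for the instantiation).  What
does NOT exist in the tree is the same at a BACKGROUND (NE2⁺ proper) or for the fine-lattice propagator species of (1.7).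
(A2) THE MISSING LAYERS between `NE2PlusOperator/Unit` and `OperatorRate`, each named and, where it is bookkeeping, proved:
 (L1) NORM PACKAGING — NE2⁺ is typed ENTRYWISE (one inequality per (3.42) entry and site pair, against the printed majorant);
 `OperatorRate` wants ONE norm on an abstract `Op`.  With `Op` = normalised entries in the sup norm over a finite entry set:
 `absRate_of_entrywise` (§2).
 (L2) RATE FACTOR → θ^k — the heart of the "exponent loss" clause.  `T4EtaRate.rateFactor g γ y = (η/len y)^γ` equals θ^k,
 θ = L^{−γ}, at sites of UNIT physical size (`rateFactor_eq_theta_pow_of_unit`; the imported `rateFactor_unit`,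
 `eta_rpow_eq_theta_pow`) and equals ONE at lattice-scale sites (`rateFactor_eq_one_of_finest`); in general it is
 (L^{scale y})^{−γ}, small exactly on RECENT scales (`rateFactor_le_of_le_scale`).  Hence NE2⁺ delivers an absolute rate c·θ^k —
 and then `OperatorRate` by (L3) — for operator species localised at unit-size sites (reading [analysis]: B13 [II]'s small-field
 step, whose localisation cubes are *"cubes from π_k(1), i.e. of the size M₁"* and whose forms (2.16) are unit-lattice kernels),
 with NO King loss at this interface; for species localised at finer multigrid sites (B9's multi-region geometries {Ω_j} at
 large-field boundaries, [III]'s R-operations) the typed discrepancy carries (L^{scale})^{−γ}: θ-small on the recent window only,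
 O(1) at old sites — there a persistent O(1) entry makes `OperatorRate` with θ < 1 FALSE under pinched margins
 (`not_absRate_of_persistent_entry`, `not_operatorRate_of_persistent`, toy `finestToy_*`), so such species belong to the
 spine's WEIGHT channel (node U5c), not to a rate binder.  King's printed absorption of the loss — p. 665 *"Redoing the analysis,
 we see that the degrees of some subgraphs have been reduced by γ; for γ small enough, the exponents D(H_i) − γ are still
 positive, and the bound proceeds as before."* — is perturbative power counting and has no printed non-perturbative counterpart;
 none is needed by a consumer that asks `OperatorRate` only of unit-localised / recent-window species (a typing remark for
 instantiations of `StepModel`: the species list, `W`, `Base`).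
 (L3) MARGIN UNITS ("δ_i/ϱ_i summable against θ^k") — `operatorRate_of_absRate` (absolute rate δ₀θ₀^k + margin floor r₀·s^k ⇒
 `OperatorRate (δ₀/r₀) θ` for θ₀ ≤ θs: [I]-type absolute margins s = 1, `operatorRate_of_absRate_floor`),
 `operatorRate_of_absRate_poly` ([III]-type radii shrinking polynomially in k ⇒ every θ > θ₀, constant δ₀·Σ(n+1)^p(θ₀/θ)ⁿ/r₀ via
 the imported `T4CauchySum.summable_succ_pow_mul_geometric`), and the converse `absRate_of_operatorRate` under a margin
 ceiling (with pinched margins the two currencies are equivalent); `operatorRate_iff_div` is the literal "δ_i/ϱ_i" reading.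
 (L4) COMPLEX DOMAIN — `OperatorRate` quantifies over the consumer's `C.BgB`, which its author instantiates with the complex
 analyticity space; `T4EtaRate`'s `Backgrounds`/`Reg335` are abstract predicates, so NE2⁺ is to be INSTANTIATED on the complex
 class (B13 p. 6: operators analytic in (𝐔, 𝐉) on the conditions I.(i)–(iii)) — no retyping, an instantiation duty.
(A3) BOOKKEEPING CONSEQUENCE [this seat's reading; the carver's call].  The cell's booking "MI-1 ≡ NE3 (node U1b)" (GAPS
G-ne5p1-2; the imported module's docstring of `OperatorRate`) should read "MI-1 = NE2/NE2⁺ (node U1a: unit layer for the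
covariances/forms of (2.5)–(2.6), (2.15)–(2.17), background layer at the canonical pair for the propagators of (1.3)–(1.7)) in
margin units, deliverable in `LocalRate` SHAPE entrywise [+ NE3 × Lipschitz only under the minimiser-reading instantiation]";
in particular closing node U1b's one-step residual (the cell's OSC / `LRRSized`) would NOT discharge `OperatorRate` for the
propagator/covariance species.  No spine count changes: NE2⁺ and NE3 are both already counted.

## What is PROVED (kernel; Mathlib + the three imported modules BY NAME; no `sorry`, no new axiom)

§1 over any `StepModel`: `AbsOperatorRate`, `MarginFloor`, `MarginFloorPoly`, `MarginCeiling` (shapes); `operatorRate_iff_div`,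
`operatorRate_of_absRate`, `operatorRate_of_absRate_floor`, `operatorRate_of_absRate_poly`, `absRate_of_operatorRate`,
`not_absRate_of_persistent`, `not_operatorRate_of_persistent`.  §2 `Op = S → ℂ` (finite entry set, sup norm): `EntrywiseRate`
(shape: normalised entries ≤ c × rate factor), `absRate_of_entrywise` (rate factors ≤ θ^k ⇒ absolute rate),
`absRate_of_localRate` (an entrywise domination by ONE `Readings` discrepancy + `T4EtaRateMin.LocalRate` BY NAME ⇒ absolute
rate: the (A1′) channel), `not_absRate_of_persistent_entry`.  §3 rate-factor facts over B9's abstract `Geometry`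
(by name from `T4EtaRate`):
`rateFactor_eq_one_of_finest`, `rateFactor_eq_theta_pow_of_unit`, `rateFactor_le_of_le_scale`.  §4 the U1b channel:
`operatorRate_of_split`, `minDist_of_localRate` (from `T4EtaRateMin.LocalRate` by name).  §5 toys: the imported `toyModel`
has `AbsOperatorRate univ 1 (1/2)` and unit margins, whence `OperatorRate univ 1 θ` for every θ ≥ 1/2 through §1
(`toy_operatorRate_of_ge`; θ = 1/2 is the imported `toy_operatorRate`); `finestToyModel` (two entries: a unit-site entry
(1/2)^k and a lattice-site entry 1/10, margins 1) satisfies `EntrywiseRate` with rate factors ((1/2)^k, 1) and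
`AbsOperatorRate univ 1 1` (bounded, NO rate) but NO `OperatorRate univ δ θ` with θ < 1 (`finestToy_not_operatorRate`) — the
typed form of (L2)'s obstruction; §3 also records `rateFactor_eq_theta_pow_scale` (rate factor = θ^{scale}).

NOT COVERED.  No operator of Bałaban's is constructed or estimated; NE2⁺, NE3, the operator Lipschitz constant, the margins and
the species list of an instantiation are hypotheses/data; which localisation sites occur in which step of [II]/[III] is a
reading, not a theorem; `T4InputCauchyRateData`, `T4EtaRate`, `T4EtaRateMin` are imported BY NAME and not modified.

CITATION HEADER (lean-in-tree rule 2026-08-18).  T. Bałaban, *Renormalization group approach to lattice gauge field theories.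
II. Cluster expansions*, Commun. Math. Phys. **116**, 1–22 (1988) [Balaban1988RG2Cluster] (cell paper B13 = [II]; journal
page = PDF page; renders `b2b-balaban-ref1/pages/1988-cmp116-rg-II-cluster/…-p003-x2.png`, `…-p016-x2.png` read as images by
this seat: (1.5)–(1.7) p. 3, (2.16)–(2.17) p. 16); T. Bałaban, *Propagators for lattice gauge theories in a background field*,
Commun. Math. Phys. **99**, 389–434 (1985) [Balaban1985BackgroundPropagators] (B9; (3.42) p. 397 and Thm 3.4 p. 400 read as
images by this lineage, gen 3, cell certificate C-pv25g3-3 / record `t4/T4-XREAD-U1a.md`); C. King, *The U(1) Higgs model. I.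
The continuum limit*, Commun. Math. Phys. **102**, 649–677 (1986) [King1986] (PUBLISHED, outside the audited series; renders
`b2b-balaban-template/king-renders/1986-cmp102-king-u1-higgs-I-p016-x2.png` = p. 664 (Prop. 3.8 (3.71)), `…-p017-x2.png` =
p. 665 (Prop. 3.9 (3.73), the "degrees reduced by γ" sentence) read as images by this seat).  What is reproduced: NOTHING of the
papers' mathematics — real bookkeeping, sup-norm packaging, two toys; the quotations are context.  NEW module of unit
`b2b-balaban-pv25-g10` (surge node prover #25, gen 10; journal XREAD-CLAIM (interface) C-ne5p1-2, 2026-08-19); v1.1 = v1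
(p185233) + `absRate_of_localRate` and paragraph (A1′) (the `LocalRate`-SHAPE channel, after the landing of
`T4Cov2156Rate`), nothing else changed.
-/

noncomputable section

open Metric Set Finset Filter Topology

namespace Literature.MathematicalPhysics.QuantumFieldTheory.Balaban1983to89.T4OperatorRateLiaison

open Literature.MathematicalPhysics.QuantumFieldTheory.Balaban1983to89.T4OutputRate
open Literature.MathematicalPhysics.QuantumFieldTheory.Balaban1983to89.T4InputCauchyRate
open Literature.MathematicalPhysics.QuantumFieldTheory.Balaban1983to89.T4InputCauchyRateData
open Literature.MathematicalPhysics.QuantumFieldTheory.Balaban1983to89.T4EtaRate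
open Literature.MathematicalPhysics.QuantumFieldTheory.Balaban1983to89.T4EtaRateMin
open Literature.MathematicalPhysics.QuantumFieldTheory.Balaban1983to89.B9

/-! ## §1 Absolute rate, margin floors/ceilings, and `OperatorRate` in margin units -/

section Margins

variable {C : Carriers} {Op Hist : Type*} [NormedAddCommGroup Op] [NormedSpace ℂ Op] [NormedAddCommGroup Hist]
  [NormedSpace ℂ Hist] (M : StepModel C Op Hist)

/-- HYPOTHESIS SHAPE `AbsOperatorRate δ₀ θ₀` (NOT PRINTED; = NE2⁺ packaged in ONE norm, see §2): the two runs' operator data at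
step `k` differ by at most `δ₀θ₀^k` in the norm of `Op` itself (no margins). [folklore] -/
def AbsOperatorRate (W : Set (ℕ → ℝ)) (δ₀ θ₀ : ℝ) : Prop :=
  ∀ k, ∀ g ∈ W, ∀ (U : C.BgB), ‖M.opA g U k - M.opB g U k‖ ≤ δ₀ * θ₀ ^ k

/-- DATA SHAPE: the operator margin is bounded below by a geometric sequence `r₀·s^k` ([I]-type absolute margins: `s = 1`;
B13 (2.16)–(2.17) p. 16 give an absolute room O(1)e^{−δ₀M/3} + O(α₀ + α₁)). [cite: Balaban1988RG2Cluster, (2.16)-(2.17) p.16] -/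
def MarginFloor (r₀ s : ℝ) : Prop := ∀ k, r₀ * s ^ k ≤ M.rOp k

/-- DATA SHAPE: the operator margin shrinks at most polynomially in the step ([III]-type radii `g_k(log g_k^{−2})^q` along a
perturbative flow `g_k^{−2} ~ k` [analysis]). [folklore] -/
def MarginFloorPoly (r₀ : ℝ) (p : ℕ) : Prop := ∀ k : ℕ, r₀ / ((k : ℝ) + 1) ^ p ≤ M.rOp k

/-- DATA SHAPE: the operator margin is bounded above (with a floor: PINCHED margins, the [I] setting). [folklore] -/
def MarginCeiling (R : ℝ) : Prop := ∀ k, M.rOp k ≤ R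

/-- The literal "δ_i/ϱ_i" reading: `OperatorRate δ θ` says discrepancy ÷ margin ≤ δθ^k. [folklore] -/
theorem operatorRate_iff_div {W : Set (ℕ → ℝ)} {δ θ : ℝ} :
    M.OperatorRate W δ θ ↔ ∀ k, ∀ g ∈ W, ∀ (U : C.BgB), ‖M.opA g U k - M.opB g U k‖ / M.rOp k ≤ δ * θ ^ k := by
  refine forall_congr' fun k => forall_congr' fun g => forall_congr' fun _ => forall_congr' fun U => ?_
  rw [div_le_iff₀ (M.rOp_pos k)]

/-- ABSOLUTE RATE + GEOMETRIC MARGIN FLOOR ⇒ `OperatorRate` in margin units, with the rate degraded by the floor's shrink factor: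
`θ₀ ≤ θ·s`. [folklore] -/
theorem operatorRate_of_absRate {W : Set (ℕ → ℝ)} {δ₀ θ₀ r₀ s θ : ℝ} (h : AbsOperatorRate M W δ₀ θ₀)
    (hfl : MarginFloor M r₀ s) (hr₀ : 0 < r₀) (hδ₀ : 0 ≤ δ₀) (hθ₀ : 0 ≤ θ₀) (hθ : 0 ≤ θ) (hθs : θ₀ ≤ θ * s) :
    M.OperatorRate W (δ₀ / r₀) θ := by
  intro k g hg U
  have hr : r₀ ≠ 0 := hr₀.ne'
  have h2 : θ₀ ^ k ≤ θ ^ k * s ^ k := by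
    rw [← mul_pow]
    exact pow_le_pow_left₀ hθ₀ hθs k
  have h3 : 0 ≤ δ₀ / r₀ * θ ^ k := mul_nonneg (div_nonneg hδ₀ hr₀.le) (pow_nonneg hθ k)
  calc ‖M.opA g U k - M.opB g U k‖ ≤ δ₀ * θ₀ ^ k := h k g hg U
    _ ≤ δ₀ * (θ ^ k * s ^ k) := mul_le_mul_of_nonneg_left h2 hδ₀
    _ = δ₀ / r₀ * θ ^ k * (r₀ * s ^ k) := by field_simp
    _ ≤ δ₀ / r₀ * θ ^ k * M.rOp k := mul_le_mul_of_nonneg_left (hfl k) h3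

/-- The [I]-type case: absolute margins bounded below by `r₀` — the rate is kept, `δ = δ₀/r₀`. [folklore] -/
theorem operatorRate_of_absRate_floor {W : Set (ℕ → ℝ)} {δ₀ θ r₀ : ℝ} (h : AbsOperatorRate M W δ₀ θ)
    (hfl : ∀ k, r₀ ≤ M.rOp k) (hr₀ : 0 < r₀) (hδ₀ : 0 ≤ δ₀) (hθ : 0 ≤ θ) : M.OperatorRate W (δ₀ / r₀) θ :=
  operatorRate_of_absRate M h (s := 1) (fun k => by simpa using hfl k) hr₀ hδ₀ hθ hθ (by simp)

/-- The [III]-type case: margins shrinking polynomially in the step cost an arbitrarily small loss of rate — every `θ > θ₀`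
is admissible, with constant `δ₀·(Σₙ (n+1)^p (θ₀/θ)ⁿ)/r₀`. [folklore] -/
theorem operatorRate_of_absRate_poly {W : Set (ℕ → ℝ)} {δ₀ θ₀ θ r₀ : ℝ} {p : ℕ} (h : AbsOperatorRate M W δ₀ θ₀)
    (hfl : MarginFloorPoly M r₀ p) (hr₀ : 0 < r₀) (hδ₀ : 0 ≤ δ₀) (hθ₀ : 0 ≤ θ₀) (hθ : θ₀ < θ) :
    ∃ δ : ℝ, 0 ≤ δ ∧ M.OperatorRate W δ θ := by
  have hθpos : 0 < θ := lt_of_le_of_lt hθ₀ hθ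
  set q : ℝ := θ₀ / θ with hq
  have hq0 : 0 ≤ q := div_nonneg hθ₀ hθpos.le
  have hq1 : q < 1 := (div_lt_one hθpos).mpr hθ
  have hsum := T4CauchySum.summable_succ_pow_mul_geometric hq0 hq1 p
  set B : ℝ := ∑' n : ℕ, ((n : ℝ) + 1) ^ p * q ^ n with hB
  have hterm : ∀ n : ℕ, ((n : ℝ) + 1) ^ p * q ^ n ≤ B := fun n =>
    hsum.le_tsum n (fun m _ => by positivity)
  have hB0 : 0 ≤ B := le_trans (by positivity) (hterm 0)
  refine ⟨δ₀ * B / r₀, by positivity, ?_⟩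
  intro k g hg U
  have hk1 : (0 : ℝ) < ((k : ℝ) + 1) ^ p := by positivity
  have hr1 : r₀ ≤ M.rOp k * ((k : ℝ) + 1) ^ p := (div_le_iff₀ hk1).mp (hfl k)
  have hθk : θ ^ k ≠ 0 := pow_ne_zero k hθpos.ne'
  have hθ₀k : θ₀ ^ k = θ ^ k * q ^ k := by
    rw [hq, div_pow]
    field_simp
  have hx : 0 ≤ δ₀ * θ ^ k * q ^ k := by positivity
  have h3 : 0 ≤ δ₀ / r₀ * θ ^ k := by positivity
  calc ‖M.opA g U k - M.opB g U k‖ ≤ δ₀ * θ₀ ^ k := h k g hg U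
    _ = δ₀ * θ ^ k * q ^ k * (r₀ / r₀) := by rw [hθ₀k, div_self hr₀.ne']; ring
    _ ≤ δ₀ * θ ^ k * q ^ k * (M.rOp k * ((k : ℝ) + 1) ^ p / r₀) :=
        mul_le_mul_of_nonneg_left (div_le_div_of_nonneg_right hr1 hr₀.le) hx
    _ = δ₀ / r₀ * θ ^ k * (((k : ℝ) + 1) ^ p * q ^ k) * M.rOp k := by ring
    _ ≤ δ₀ / r₀ * θ ^ k * B * M.rOp k :=
        mul_le_mul_of_nonneg_right (mul_le_mul_of_nonneg_left (hterm k) h3) (M.rOp_pos k).le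
    _ = δ₀ * B / r₀ * θ ^ k * M.rOp k := by ring

/-- Converse under a margin CEILING: `OperatorRate` in margin units gives an absolute rate with the same θ.  With pinched
margins (`r₀ ≤ rOp k ≤ R`) the two currencies are therefore equivalent up to the constants `r₀`, `R`. [folklore] -/
theorem absRate_of_operatorRate {W : Set (ℕ → ℝ)} {δ θ R : ℝ} (h : M.OperatorRate W δ θ) (hceil : MarginCeiling M R)
    (hδ : 0 ≤ δ) (hθ : 0 ≤ θ) : AbsOperatorRate M W (δ * R) θ := by
  intro k g hg U
  have h3 : 0 ≤ δ * θ ^ k := mul_nonneg hδ (pow_nonneg hθ k)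
  calc ‖M.opA g U k - M.opB g U k‖ ≤ δ * θ ^ k * M.rOp k := h k g hg U
    _ ≤ δ * θ ^ k * R := mul_le_mul_of_nonneg_left (hceil k) h3
    _ = δ * R * θ ^ k := by ring

/-- OBSTRUCTION: a discrepancy that PERSISTS at size `c₀ > 0` along the steps (at one coupling sequence and background) admits
no absolute rate with `θ < 1`, whatever the constant. [folklore] -/
theorem not_absRate_of_persistent {W : Set (ℕ → ℝ)} {δ θ c₀ : ℝ} {g : ℕ → ℝ} (hg : g ∈ W) (U : C.BgB) (hc₀ : 0 < c₀)
    (hpers : ∀ k, c₀ ≤ ‖M.opA g U k - M.opB g U k‖) (hθ0 : 0 ≤ θ) (hθ1 : θ < 1) :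
    ¬ AbsOperatorRate M W δ θ := by
  intro h
  have ht : Tendsto (fun k : ℕ => δ * θ ^ k) atTop (𝓝 0) := by
    simpa using (tendsto_pow_atTop_nhds_zero_of_lt_one hθ0 hθ1).const_mul δ
  obtain ⟨k, hk⟩ := (ht.eventually (gt_mem_nhds hc₀)).exists
  exact absurd ((hpers k).trans (h k g hg U)) (not_le.mpr hk)

/-- … hence, under a margin ceiling, no `OperatorRate` with `θ < 1` either (for `δ ≥ 0`; a negative `δ` is refuted by the
first persistent step directly). [folklore] -/
theorem not_operatorRate_of_persistent {W : Set (ℕ → ℝ)} {δ θ c₀ R : ℝ} {g : ℕ → ℝ} (hg : g ∈ W) (U : C.BgB)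
    (hc₀ : 0 < c₀) (hpers : ∀ k, c₀ ≤ ‖M.opA g U k - M.opB g U k‖) (hceil : MarginCeiling M R) (hθ0 : 0 ≤ θ)
    (hθ1 : θ < 1) : ¬ M.OperatorRate W δ θ := by
  intro h
  rcases le_or_gt 0 δ with hδ | hδ
  · exact not_absRate_of_persistent M hg U hc₀ hpers hθ0 hθ1 (absRate_of_operatorRate M h hceil hδ hθ0)
  · have h0 := (hpers 0).trans (h 0 g hg U)
    have : δ * θ ^ 0 * M.rOp 0 < 0 := by
      rw [pow_zero, mul_one]
      exact mul_neg_of_neg_of_pos hδ (M.rOp_pos 0)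
    linarith

end Margins

/-! ## §2 Entrywise rates with a per-entry rate factor, packaged in the sup norm over a finite entry set -/

section Entrywise

variable {C : Carriers} {S Hist : Type*} [Fintype S] [NormedAddCommGroup Hist] [NormedSpace ℂ Hist]
  (M : StepModel C (S → ℂ) Hist)

/-- HYPOTHESIS SHAPE `EntrywiseRate c rf` (= the shape of `T4EtaRate.EtaRateIneq342` / `EtaRateIneqSite` / `EtaRateIneqUnit`
after dividing each entry by its printed majorant: an entry `s` stands for a (3.42)-entry together with its pair of localisation
sites, and `rf k s ∈ [0, 1]` for `max (rateFactor y) (rateFactor y′)` at step `k`; NOT PRINTED): the normalised entries of the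
two runs' operator data differ by at most `c × (rate factor)` (the rate factor's printed model: King's Prop. 3.9 (3.73),
p. 665 of [King1986]). [cite: Balaban1985BackgroundPropagators, (3.42) p.397] -/
def EntrywiseRate (W : Set (ℕ → ℝ)) (c : ℝ) (rf : ℕ → S → ℝ) : Prop :=
  ∀ k, ∀ g ∈ W, ∀ (U : C.BgB) (s : S), ‖M.opA g U k s - M.opB g U k s‖ ≤ c * rf k s

/-- NORM PACKAGING: if every entry's rate factor at step `k` is at most `θ^k` (all localisation sites of UNIT physical size,
§3 `rateFactor_eq_theta_pow_of_unit`), the entrywise rate is an absolute rate `c·θ^k` in the sup norm. [folklore] -/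
theorem absRate_of_entrywise {W : Set (ℕ → ℝ)} {c θ : ℝ} {rf : ℕ → S → ℝ} (h : EntrywiseRate M W c rf)
    (hunit : ∀ k s, rf k s ≤ θ ^ k) (hc : 0 ≤ c) (hθ : 0 ≤ θ) : AbsOperatorRate M W c θ := by
  intro k g hg U
  rw [pi_norm_le_iff_of_nonneg (by positivity)]
  intro s
  calc ‖(M.opA g U k - M.opB g U k) s‖ = ‖M.opA g U k s - M.opB g U k s‖ := rfl
    _ ≤ c * rf k s := h k g hg U s
    _ ≤ c * θ ^ k := mul_le_mul_of_nonneg_left (hunit k s) hc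

/-- THE (A1′) CHANNEL — `LocalRate` BY NAME, read as an entrywise OPERATOR rate: if every entry of the two runs' operator
discrepancy at step `k` is dominated by ONE consecutive-step discrepancy `|R.loc (k+1) V x − R.loc k V x|` of a `Readings`
carrier (datum `V ∈ R.dom` and site `x` chosen per step, coupling sequence, background and entry — e.g. `V = ()` and
`x` = the entry's bond pair for the hypothesis-free instance `T4Cov2156Rate.cov2156_localRate` of the covariance species at
U = 1), then `LocalRate R C θ` gives the absolute rate `C·θ^k` in the sup norm. [folklore] -/
theorem absRate_of_localRate {ι X : Type*} (R : Readings ι X) {Cr θ : ℝ} (hR : LocalRate R Cr θ) (hCr : 0 ≤ Cr)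
    (hθ : 0 ≤ θ) {W : Set (ℕ → ℝ)} (v : ℕ → (ℕ → ℝ) → C.BgB → S → ι) (e : ℕ → (ℕ → ℝ) → C.BgB → S → X)
    (hv : ∀ k, ∀ g ∈ W, ∀ (U : C.BgB) (s : S), v k g U s ∈ R.dom)
    (hdom : ∀ k, ∀ g ∈ W, ∀ (U : C.BgB) (s : S),
      ‖M.opA g U k s - M.opB g U k s‖ ≤ |R.loc (k + 1) (v k g U s) (e k g U s) - R.loc k (v k g U s) (e k g U s)|) :
    AbsOperatorRate M W Cr θ := by
  intro k g hg U
  rw [pi_norm_le_iff_of_nonneg (by positivity)]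
  intro s
  calc ‖(M.opA g U k - M.opB g U k) s‖ = ‖M.opA g U k s - M.opB g U k s‖ := rfl
    _ ≤ |R.loc (k + 1) (v k g U s) (e k g U s) - R.loc k (v k g U s) (e k g U s)| := hdom k g hg U s
    _ ≤ Cr * θ ^ k := hR k (v k g U s) (hv k g hg U s) (e k g U s)

/-- OBSTRUCTION, entrywise form: ONE entry whose discrepancy persists at size `c₀ > 0` (a lattice-scale site, rate factor 1,
with a non-vanishing lattice artefact) forbids every absolute rate with `θ < 1` in the sup norm. [folklore] -/
theorem not_absRate_of_persistent_entry {W : Set (ℕ → ℝ)} {δ θ c₀ : ℝ} {g : ℕ → ℝ} (hg : g ∈ W) (U : C.BgB) (s₀ : S)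
    (hc₀ : 0 < c₀) (hpers : ∀ k, c₀ ≤ ‖M.opA g U k s₀ - M.opB g U k s₀‖) (hθ0 : 0 ≤ θ) (hθ1 : θ < 1) :
    ¬ AbsOperatorRate M W δ θ :=
  not_absRate_of_persistent M hg U hc₀
    (fun k => (hpers k).trans (norm_le_pi_norm (M.opA g U k - M.opB g U k) s₀)) hθ0 hθ1

end Entrywise

/-! ## §3 The rate factor at unit, lattice and intermediate scales (over B9's abstract geometry, by name from `T4EtaRate`) -/

section RateFactor

variable {g : Geometry}

/-- At a LATTICE-SCALE site (scale index 0, physical size η) the rate factor is ONE: no smallness at all — lattice artefacts are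
O(1) at the lattice scale. [folklore] -/
theorem rateFactor_eq_one_of_finest (hη : g.eta ≠ 0) (γ : ℝ) {y : g.Site} (hy : g.scale y = 0) :
    rateFactor g γ y = 1 := by
  unfold rateFactor Geometry.len
  rw [hy, pow_zero, one_mul, div_self hη, Real.one_rpow]

/-- At a UNIT-SIZE site the rate factor is the clean geometric rate θ^k, θ = L^{−γ} (the imported `rateFactor_unit` and
`eta_rpow_eq_theta_pow` composed). [folklore] -/
theorem rateFactor_eq_theta_pow_of_unit (hη : g.eta = (g.L ^ g.k)⁻¹) (hL : 0 < g.L) (γ : ℝ) {y : g.Site}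
    (hy : g.len y = 1) : rateFactor g γ y = (g.L ^ (-γ)) ^ g.k := by
  rw [rateFactor_unit γ hy, eta_rpow_eq_theta_pow hη hL]

/-- In general the rate factor is `(L^{−γ})^{scale y}`: a site averaged `j` times carries `θ^j`, NOT `θ^k` — small exactly on
RECENT scales. [folklore] -/
theorem rateFactor_eq_theta_pow_scale (hη : g.eta ≠ 0) (hL : 0 < g.L) (γ : ℝ) (y : g.Site) :
    rateFactor g γ y = (g.L ^ (-γ)) ^ g.scale y := by
  rw [rateFactor_eq_rpow_scale hη hL γ y, ← Real.rpow_natCast (g.L ^ (-γ)), ← Real.rpow_mul hL.le, mul_comm,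
    Real.rpow_mul hL.le, Real.rpow_natCast]

/-- … so on the window of scales `≥ j` the rate factor is at most `θ^j` (L ≥ 1, γ ≥ 0). [folklore] -/
theorem rateFactor_le_of_le_scale (hη : g.eta ≠ 0) (hL : 1 ≤ g.L) {γ : ℝ} (hγ : 0 ≤ γ) {y : g.Site} {j : ℕ}
    (hj : j ≤ g.scale y) : rateFactor g γ y ≤ (g.L ^ (-γ)) ^ j := by
  have hL0 : 0 < g.L := lt_of_lt_of_le zero_lt_one hL
  rw [rateFactor_eq_theta_pow_scale hη hL0 γ y]
  have hθ0 : 0 ≤ g.L ^ (-γ) := Real.rpow_nonneg hL0.le _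
  have hθ1 : g.L ^ (-γ) ≤ 1 := Real.rpow_le_one_of_one_le_of_nonpos hL (by linarith)
  exact pow_le_pow_of_le_one hθ0 hθ1 hj

end RateFactor

/-! ## §4 The U1b (minimiser) channel: where typed NE3 WOULD enter the operator binder -/

section Split

variable {C : Carriers} {Op Hist : Type*} [NormedAddCommGroup Op] [NormedSpace ℂ Op] [NormedAddCommGroup Hist]
  [NormedSpace ℂ Hist] (M : StepModel C Op Hist)

/-- THE LIPSCHITZ SPLIT (bookkeeping): if an instantiation reads the operators at the runs' OWN minimisers of a common datum,
insert the intermediate family `opMid` (run A's lattice spacing, run B's minimiser transported): `opA − opB = (opA − opMid) +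
(opMid − opB)` = [NE2⁺ at the canonical pair, margin units] + [operator Lipschitz in the background, `Λ` margins per unit
distance — printed-TYPE from B9 Thm 3.4's analyticity by a Cauchy estimate] × [minimiser distance ≤ C_m θ^k = NE3].
[cite: Balaban1985BackgroundPropagators, Thm 3.4 p.400] -/
theorem operatorRate_of_split {W : Set (ℕ → ℝ)} {δ₁ Λ Cm θ : ℝ} (opMid : (ℕ → ℝ) → C.BgB → ℕ → Op)
    (dist : ℕ → (ℕ → ℝ) → C.BgB → ℝ)
    (hEta : ∀ k, ∀ g ∈ W, ∀ (U : C.BgB), ‖M.opA g U k - opMid g U k‖ ≤ δ₁ * θ ^ k * M.rOp k)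
    (hLip : ∀ k, ∀ g ∈ W, ∀ (U : C.BgB), ‖opMid g U k - M.opB g U k‖ ≤ Λ * dist k g U * M.rOp k)
    (hMin : ∀ k, ∀ g ∈ W, ∀ (U : C.BgB), dist k g U ≤ Cm * θ ^ k) (hΛ : 0 ≤ Λ) :
    M.OperatorRate W (δ₁ + Λ * Cm) θ := by
  intro k g hg U
  have hr := (M.rOp_pos k).le
  calc ‖M.opA g U k - M.opB g U k‖
        ≤ ‖M.opA g U k - opMid g U k‖ + ‖opMid g U k - M.opB g U k‖ := norm_sub_le_norm_sub_add_norm_sub _ _ _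
    _ ≤ δ₁ * θ ^ k * M.rOp k + Λ * dist k g U * M.rOp k := add_le_add (hEta k g hg U) (hLip k g hg U)
    _ ≤ δ₁ * θ ^ k * M.rOp k + Λ * (Cm * θ ^ k) * M.rOp k :=
        add_le_add le_rfl (mul_le_mul_of_nonneg_right (mul_le_mul_of_nonneg_left (hMin k g hg U) hΛ) hr)
    _ = (δ₁ + Λ * Cm) * θ ^ k * M.rOp k := by ring

/-- NE3 BY NAME: a minimiser distance dominated, at every step, coupling sequence and background, by ONE site reading
discrepancy of `T4EtaRateMin.Readings` inherits the rate of `LocalRate`. [folklore] -/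
theorem minDist_of_localRate {ι X : Type*} (R : Readings ι X) {Cm θ : ℝ} (hR : LocalRate R Cm θ) {W : Set (ℕ → ℝ)}
    (dist : ℕ → (ℕ → ℝ) → C.BgB → ℝ)
    (hdom : ∀ k, ∀ g ∈ W, ∀ (U : C.BgB), ∃ V ∈ R.dom, ∃ x : X, dist k g U ≤ |R.loc (k + 1) V x - R.loc k V x|) :
    ∀ k, ∀ g ∈ W, ∀ (U : C.BgB), dist k g U ≤ Cm * θ ^ k := by
  intro k g hg U
  obtain ⟨V, hV, x, hx⟩ := hdom k g hg U
  exact hx.trans (hR k V hV x)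

end Split

/-! ## §5 Toys: the imported toy model's operator rate recovered through §1; a two-entry model with a lattice-site entry -/

section Toy

/-- The imported toy model has the absolute rate `(1/2)^k`. [folklore] -/
theorem toy_absRate : AbsOperatorRate toyModel Set.univ 1 (1 / 2) := by
  intro k g _ U
  show ‖(((1 / 2 : ℝ) ^ k : ℝ) : ℂ) - 0‖ ≤ 1 * (1 / 2) ^ k
  rw [sub_zero, Complex.norm_real, Real.norm_eq_abs, abs_of_nonneg (by positivity), one_mul]

/-- … and unit margins. [folklore] -/
theorem toy_marginFloor : MarginFloor toyModel 1 1 := by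
  intro k
  show (1 : ℝ) * 1 ^ k ≤ 1
  simp

/-- … so through `operatorRate_of_absRate` it has `OperatorRate univ 1 θ` for EVERY `θ ≥ 1/2` (at `θ = 1/2` this is the
imported `toy_operatorRate`, recovered rather than restated). [folklore] -/
theorem toy_operatorRate_of_ge {θ : ℝ} (hθ : 1 / 2 ≤ θ) : toyModel.OperatorRate Set.univ 1 θ := by
  have h := operatorRate_of_absRate toyModel toy_absRate toy_marginFloor one_pos zero_le_one (by norm_num)
    (θ := θ) (by linarith) (by simpa using hθ)
  simpa using h

/-- A two-entry toy: entry 0 is a UNIT-site entry with discrepancy (1/2)^k, entry 1 a LATTICE-site entry with the persistent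
artefact 1/10; run B ≡ 0; output, insertions and base class trivial; margins 1. [folklore] -/
def finestToyModel : StepModel toyCarriers (Fin 2 → ℂ) ℂ where
  Out := fun _ _ _ _ => 0
  opA := fun _ _ k => ![(((1 / 2 : ℝ) ^ k : ℝ) : ℂ), ((1 / 10 : ℝ) : ℂ)]
  opB := fun _ _ _ => 0
  insA := fun _ _ _ _ => 0
  insB := fun _ _ _ _ => 0
  Base := fun _ _ _ => Set.univ
  rOp := fun _ => 1
  rHist := fun _ => 1
  rOp_pos := fun _ => one_pos
  rHist_pos := fun _ => one_pos

/-- The two-entry toy's rate factors: θ^k = (1/2)^k at the unit-site entry, ONE at the lattice-site entry. [folklore] -/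
def finestToyRf (k : ℕ) : Fin 2 → ℝ := ![(1 / 2 : ℝ) ^ k, 1]

/-- The toy satisfies the NE2⁺-shaped entrywise rate with constant 1. [folklore] -/
theorem finestToy_entrywise : EntrywiseRate finestToyModel Set.univ 1 finestToyRf := by
  intro k g _ U s
  fin_cases s
  · show ‖(((1 / 2 : ℝ) ^ k : ℝ) : ℂ) - 0‖ ≤ 1 * (1 / 2 : ℝ) ^ k
    rw [sub_zero, Complex.norm_real, Real.norm_eq_abs, abs_of_nonneg (by positivity), one_mul]
  · show ‖(((1 / 10 : ℝ)) : ℂ) - 0‖ ≤ 1 * 1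
    rw [sub_zero, Complex.norm_real, Real.norm_eq_abs, abs_of_nonneg (by positivity)]
    norm_num

/-- … and a BOUNDED discrepancy (absolute "rate" with θ = 1). [folklore] -/
theorem finestToy_absRate_one : AbsOperatorRate finestToyModel Set.univ 1 1 :=
  absRate_of_entrywise finestToyModel finestToy_entrywise
    (fun k s => by
      fin_cases s
      · show (1 / 2 : ℝ) ^ k ≤ 1 ^ k
        exact pow_le_pow_left₀ (by norm_num) (by norm_num) k
      · show (1 : ℝ) ≤ 1 ^ k
        simp)
    zero_le_one zero_le_one

/-- … but the lattice-site entry persists at 1/10. [folklore] -/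
theorem finestToy_persistent (k : ℕ) (g : ℕ → ℝ) (U : toyCarriers.BgB) :
    (1 / 10 : ℝ) ≤ ‖finestToyModel.opA g U k 1 - finestToyModel.opB g U k 1‖ := by
  show (1 / 10 : ℝ) ≤ ‖(((1 / 10 : ℝ)) : ℂ) - 0‖
  rw [sub_zero, Complex.norm_real, Real.norm_eq_abs, abs_of_nonneg (by positivity)]

/-- … so NO absolute rate with θ < 1 holds, for any constant. [folklore] -/
theorem finestToy_not_absRate {δ θ : ℝ} (hθ0 : 0 ≤ θ) (hθ1 : θ < 1) :
    ¬ AbsOperatorRate finestToyModel Set.univ δ θ :=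
  not_absRate_of_persistent_entry finestToyModel (g := fun _ => 0) (Set.mem_univ _) () 1 (by norm_num)
    (finestToy_persistent · _ _) hθ0 hθ1

/-- … and NO `OperatorRate` with θ < 1 either (margins pinched at 1): the typed form of the obstruction "rate factor 1 at a
lattice-scale site". [folklore] -/
theorem finestToy_not_operatorRate {δ θ : ℝ} (hθ0 : 0 ≤ θ) (hθ1 : θ < 1) :
    ¬ finestToyModel.OperatorRate Set.univ δ θ :=
  not_operatorRate_of_persistent finestToyModel (g := fun _ => 0) (Set.mem_univ _) () (by norm_num : (0 : ℝ) < 1 / 10)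
    (fun k => (finestToy_persistent k (fun _ => 0) ()).trans
      (norm_le_pi_norm (finestToyModel.opA (fun _ => 0) () k - finestToyModel.opB (fun _ => 0) () k) 1))
    (fun _ => le_rfl) hθ0 hθ1

end Toy

end Literature.MathematicalPhysics.QuantumFieldTheory.Balaban1983to89.T4OperatorRateLiaison

end
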